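import Literature.MathematicalPhysics.QuantumFieldTheory.Balaban1983to89.B9Eq349ConjugatedGreenLetters

/-!
# `Balaban1983to89.B9Eq326ConjugatedDeltaALetters` — T. Bałaban, *Propagators for lattice gauge theories in a background field*, Commun. Math. Phys. **99**
# (1985) 389–434 [Balaban1985BackgroundPropagators] (3.26) p. 395, (3.21)∕(3.25) p. 394, (3.10) p. 392, Thm 3.11 p. 416 with [Balaban1985Variational] (110)
# p. 294: **PERTURBED COERCIVITY AND THE CONJUGATED-INVERSE BOUND FOR AN OPERATOR OF THE SHAPE OF `Δ_a(U) = D*D + Δ′ + D R D* + aQ*Q` ITSELF —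
# two squares, ONE PROJECTED SQUARE `B₂†RB₂` (`R` an orthogonal projection) and a bounded remainder `K`**: if `γ‖f‖² ≤ re⟪f, Hf⟫`, `re⟪f, Kf⟫ ≥ −p_K‖f‖²`,
# the complementary projection of the divergence is BOUNDED, `‖B₂f − R(B₂f)‖ ≤ C_P‖f‖`, and the conjugated letters are close (`‖B_{i,κ} − B_i‖,
# ‖B′_{i,κ} − B_i†‖, ‖Q_κ − Q‖, ‖Q′_κ − Q†‖ ≤ β`, `‖K_κ − K‖ ≤ β_K`, `‖R_κ − R‖ ≤ ρ ≤ 1∕8`) on the window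
# `p_K∕2 + (21 + 3a)β² + 4βC_P + 2ρC_P² + β_K ≤ γ∕4`, then `(γ∕4)‖f‖² ≤ re⟪f, H_κf⟫` and any right inverse `G_κ` of `H_κ` obeys `‖G_κ‖ ≤ 4∕γ` —
# abstract finite-dimensional `𝕜`-Hilbert letters, the `Δ_a` twin of `B9Eq326ConjugatedLocalLetters` (the local part `A₀`, NE9 owner plan v11 (D0-b))

statement-level skeleton of published theorems with citation tags; proofs where landed; nothing here is a claim about the Yang–Mills mass gap

CITATION HEADER (lean-in-tree rule).  Audit cell `pub-balaban`, sub-cell `t4`, BINDER row NE9; filed by NE9 formalisation-swarm leaf prover 03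
(`b2b-balaban-t4-ne9-formalise-leaf-03`, gen 75).  Imports `B9Eq349ConjugatedGreenLetters` (ne9-leaf-05's port of t4-ne9-idea-1's kernel: `re_inner_perturbed`,
the second-order perturbation bound of a conjugated square) only; Mathlib otherwise.  Sources READ first-hand (`paper:balaban1985-cmp99-background-propagators`,
journal page = PDF page + 388): p. 395 (3.26) *«Δ_a(U) = Δ(U) + D_UR(U)D*_U + Q*(U)aQ(U)»*, p. 394 (3.21) *«R = R(U) is an orthogonal projection in the Hilbert
space L²(Ω₀, g) onto the subspace R = Δ_U N(Q′)»*, (3.25) *«Rf = (I − G′Q′*(Q′G′²Q′*)⁻¹Q′G′)f»*, p. 392 (3.10) *«⟨A, ΔA⟩ = ⟨A, D*DA⟩ + ⟨A, Δ′A⟩»*, p. 416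
Thm 3.11 *«the operators … Δ_a, G are positive, uniformly bounded from below … the kernels … decay exponentially»*; [Balaban1985Variational] p. 294 *«We
denote by G₁ an inverse operator to the operator Δ₁ + DRD* + aQ*Q.»*  Print's decay proof is the random walk of Sect. C with local gauge fixing (p. 416);
the conjugation `e^{κχ}(·)e^{−κχ}` is the ROUTE's Combes–Thomas substitute (`t4/ROUTES-NE9.md` §L1.2 road B8″); nothing of print's rate is asserted.

WHY THIS FILE (cell context; NE9 owner plan v11 `g91/PLAN-V11-STOREY-G1.md` §2).  The owner's Kato∕energy route reaches the LOCAL part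
`A₀ = D*D + DD* + Δ′ + aQ*Q` ((D0-b) `B9Eq326ConjugatedLocalLetters`, (D0-c), (D0-d)) and routes `G₁ = Δ_a⁻¹ = (A₀ − DPD*)⁻¹` through the Woodbury identity,
the gradient rows of `A₀⁻¹` (storey J) and a coarse-lattice Combes–Thomas for the Schur complement.  IN `L²` THE TERM `−DPD*` IS NOT AN OBSTRUCTION:
`D(1 − P)D* = DRD*` is a PROJECTED square, and (D0-b)'s argument — each conjugated square keeps half of itself — survives for a projected square as soon as
the complementary part `PD* = (1 − R)D*` is a BOUNDED operator (`‖PD*‖ ≤ C_P`; on the chain `P D* = G′Q̃′†·c·Q̃′·(G′D*)` and `‖G′D*‖ ≤ √‖G′‖` by energy,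
so `C_P` is a letter of `G′`, `Q̃′` and `κ₁` only — discharged in the instance files, NOT here).  So the conjugated inverse `S G₁ S⁻¹` is bounded by `4∕γ`
from letters the tree already holds, and the `L²` block decay of `G₁` follows by the Cauchy∕block read-out of road B8″ — with NO gradient row.

WHAT IS PROVED (sorry-free; proof lane — no `def`; [folklore] Hilbert-space algebra).  Spaces `E` (bond fields), `P` (plaquette fields), `S` (site fields),
`F` (block fields); `B₁ : E → P` (the curl), `B₂ : E → S` (the divergence `D*`, whose adjoint is `D`), `R : S → S` with `re⟪s, Rs⟫ = ‖Rs‖²` and `‖Rs‖ ≤ ‖s‖`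
(an orthogonal projection), `Q : E → F`, `K : E → E`; `H f = B₁†(B₁f) + B₂†(R(B₂f)) + Kf + a•Q†(Qf)`.
* §0 **`re_inner_projected_perturbed`** — for letters `T_κ ≈ T`, `T′_κ ≈ T†` within `β`, `R_κ ≈ R` within `ρ ≤ 1∕8`, and `‖Tf − R(Tf)‖ ≤ C‖f‖`:
  `½‖R(Tf)‖² − (2ρC² + 4βC + 18β²)‖f‖² ≤ re⟪f, T′_κ(R_κ(T_κf))⟫`.
* §1 **`re_inner_H_eq`** — `re⟪f, Hf⟫ = ‖B₁f‖² + ‖R(B₂f)‖² + re⟪f, Kf⟫ + a‖Qf‖²`.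
* §2 the conjugated family `H_κ f = B′_{1,κ}(B_{1,κ}f) + B′_{2,κ}(R_κ(B_{2,κ}f)) + K_κf + a•Q′_κ(Q_κf)`: **`coercive_k_projected`** (`(γ∕4)‖f‖² ≤
  re⟪f, H_κf⟫` on the window), **`norm_Gk_le_projected`** (`‖G_κ‖ ≤ 4∕γ` for `H_κG_κ = 1`), and the unconjugated reading **`norm_G_le_projected`**
  (`β = β_K = ρ = 0`: `‖H⁻¹‖ ≤ 4∕γ` whenever `p_K ≤ γ∕2`, for every `C_P`).  (Names carry `_projected` to stay distinct from the local part's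
  `B9Eq326ConjugatedLocalLetters.coercive_k` ∕ `norm_Gk_le` ∕ `norm_G_le`, whose hypotheses these extend by `R`, `ρ`, `C_P`.)
HONEST SCOPE.  Abstract letters; the instance at the chain's `Δ_a(U)` (`B9Eq326OperatorAssembly.laplaceAofU`, `R := RofU`, `γ` from Thm 3.11 DISPLAYED,
`β` from `B9Eq3101ConjugationLettersCurl`∕`…CoCurl`∕`…Chain`, `ρ` and `C_P` from their own letter files, `p_K`, `β_K`, the `Q` letters displayed) is the
next brick; nothing of [B9] Thm 3.1∕3.3∕3.11 asserted; «NE9 ⇐ the named binders»; NE9 NOT PRINTED ∕ NOT PROVED; row WALLED ON A MODEL (O-NE9-1; #5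
UNRULED); spine PROVED 0∕9; rung (B)+1 on a finite T⁴ — NOT infinite volume, NOT mass gap, NOT BetaPertH, NOT Clay.  HONEST DEPENDENCY: continuum YM on
T⁴ ⇐ BetaPertH ∧ nine spine estimates (0/9 proved); BetaPertH ⇐ (D1) ∧ (D4) ∧ CAP+tail.  NEW file; nothing modified.  Net new unproved facts: 0.
-/

noncomputable section

open scoped InnerProductSpace ComplexConjugate

namespace Literature.MathematicalPhysics.QuantumFieldTheory.Balaban1983to89.B9Eq326ConjugatedDeltaALetters

open B9Eq349ConjugatedGreenLetters (re_inner_perturbed)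

variable {𝕜 : Type*} [RCLike 𝕜]
  {E : Type*} [NormedAddCommGroup E] [InnerProductSpace 𝕜 E] [FiniteDimensional 𝕜 E]
  {P : Type*} [NormedAddCommGroup P] [InnerProductSpace 𝕜 P] [FiniteDimensional 𝕜 P]
  {S : Type*} [NormedAddCommGroup S] [InnerProductSpace 𝕜 S] [FiniteDimensional 𝕜 S]
  {F : Type*} [NormedAddCommGroup F] [InnerProductSpace 𝕜 F] [FiniteDimensional 𝕜 F]

section RealPart
variable {V : Type*} [NormedAddCommGroup V] [InnerProductSpace 𝕜 V]

/-- `re⟪x, y⟫ ≤ ‖x‖‖y‖`. [folklore] [cite: Balaban1985BackgroundPropagators, (3.11) p.392] -/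
private theorem re_inner_le_mul_norm' (x y : V) : RCLike.re ⟪x, y⟫_𝕜 ≤ ‖x‖ * ‖y‖ :=
  (RCLike.re_le_norm _).trans (norm_inner_le_norm x y)

/-- `−‖x‖‖y‖ ≤ re⟪x, y⟫`. [folklore] [cite: Balaban1985BackgroundPropagators, (3.11) p.392] -/
private theorem neg_mul_norm_le_re_inner' (x y : V) : -(‖x‖ * ‖y‖) ≤ RCLike.re ⟪x, y⟫_𝕜 := by
  have h1 := (abs_le.1 (RCLike.abs_re_le_norm ⟪x, y⟫_𝕜)).1
  have h2 := norm_inner_le_norm (𝕜 := 𝕜) x y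
  linarith

end RealPart

/-! ## §0 The projected perturbed square `T′_κ R_κ T_κ` -/

/-- The real polynomial inequality behind `re_inner_projected_perturbed`: with `X = ‖R(Tf)‖`, `u = ‖f‖`, `Y = X + Cu ≥ ‖Tf‖`,
`X² − ρY(Y + βu) − Y·βu − βu(1+ρ)(Y + βu) ≥ ½X² − (2ρC² + 4βC + 18β²)u²` for `ρ ≤ 1∕8` (`2ρCXu ≤ ρX² + ρC²u²`, `(9∕4)βXu ≤ ¼X² + (81∕16)β²u²`).
[folklore] [cite: Balaban1985BackgroundPropagators, (3.49) p.399] -/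
private theorem poly_step {X u C β ρ : ℝ} (hX : 0 ≤ X) (hu : 0 ≤ u) (hC : 0 ≤ C) (hβ : 0 ≤ β) (hρ : 0 ≤ ρ) (hρ8 : ρ ≤ 1 / 8) :
    1 / 2 * X ^ 2 - (2 * ρ * C ^ 2 + 4 * β * C + 18 * β ^ 2) * u ^ 2 ≤
      X ^ 2 - ρ * (X + C * u) * (X + C * u + β * u) - (X + C * u) * (β * u) - β * u * ((1 + ρ) * (X + C * u + β * u)) := by
  have h1 : 0 ≤ ρ * (X - C * u) ^ 2 := mul_nonneg hρ (sq_nonneg _)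
  have h2 : 0 ≤ (1 / 2 * X - 9 / 4 * (β * u)) ^ 2 := sq_nonneg _
  have h3 : 0 ≤ (1 / 8 - ρ) * (β * u * X) := mul_nonneg (by linarith) (by positivity)
  have h4 : 0 ≤ (1 / 8 - ρ) * X ^ 2 := mul_nonneg (by linarith) (sq_nonneg _)
  have h5 : 0 ≤ (1 - ρ) * (β * C * u ^ 2) := mul_nonneg (by linarith) (by positivity)
  have h6 : 0 ≤ (1 / 8 - ρ) * (β * C * u ^ 2) := mul_nonneg (by linarith) (by positivity)
  have h7 : 0 ≤ (1 / 8 - ρ) * (β ^ 2 * u ^ 2) := mul_nonneg (by linarith) (by positivity)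
  have h8 : 0 ≤ β ^ 2 * u ^ 2 := by positivity
  nlinarith [h1, h2, h3, h4, h5, h6, h7, h8]

section Projected

variable (T : E →ₗ[𝕜] S) (R : S →ₗ[𝕜] S) (Tk : E →ₗ[𝕜] S) (Tk' : S →ₗ[𝕜] E) (Rk : S →ₗ[𝕜] S) {β ρ C : ℝ}
  (hβ : 0 ≤ β) (hρ : 0 ≤ ρ) (hρ8 : ρ ≤ 1 / 8) (hC : 0 ≤ C)
  (hRsq : ∀ s, RCLike.re ⟪s, R s⟫_𝕜 = ‖R s‖ ^ 2) (hR1 : ∀ s, ‖R s‖ ≤ ‖s‖)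
  (dT : ∀ f, ‖Tk f - T f‖ ≤ β * ‖f‖) (dT' : ∀ s, ‖Tk' s - LinearMap.adjoint T s‖ ≤ β * ‖s‖) (dR : ∀ s, ‖Rk s - R s‖ ≤ ρ * ‖s‖)
  (hP : ∀ f, ‖T f - R (T f)‖ ≤ C * ‖f‖)

include hβ hρ hρ8 hC hRsq hR1 dT dT' dR hP in
/-- **THE PROJECTED PERTURBED SQUARE keeps half of itself**: for `R` an orthogonal projection (`re⟪s, Rs⟫ = ‖Rs‖²`, `‖Rs‖ ≤ ‖s‖`), letters `‖T_κ − T‖,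
‖T′_κ − T†‖ ≤ β`, `‖R_κ − R‖ ≤ ρ ≤ 1∕8`, and a BOUNDED complementary part `‖Tf − R(Tf)‖ ≤ C‖f‖`,
`½‖R(Tf)‖² − (2ρC² + 4βC + 18β²)‖f‖² ≤ re⟪f, T′_κ(R_κ(T_κf))⟫` — the one new inequality of this file: with `w = Tf`, `z = R_κ(T_κf)`,
`re⟪f, T′_κz⟫ ≥ re⟪w, z⟫ − β‖f‖‖z‖`, `re⟪w, z⟫ ≥ ‖Rw‖² − ρ‖w‖‖T_κf‖ − β‖w‖‖f‖`, `‖z‖ ≤ (1+ρ)(‖w‖ + β‖f‖)` and `‖w‖ ≤ ‖Rw‖ + C‖f‖`. [folklore]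
[cite: Balaban1985BackgroundPropagators, (3.26) p.395, (3.21) p.394, (3.49) p.399] -/
theorem re_inner_projected_perturbed (f : E) :
    1 / 2 * ‖R (T f)‖ ^ 2 - (2 * ρ * C ^ 2 + 4 * β * C + 18 * β ^ 2) * ‖f‖ ^ 2 ≤ RCLike.re ⟪f, Tk' (Rk (Tk f))⟫_𝕜 := by
  set w := T f with hw
  set z := Rk (Tk f) with hz
  -- (1) move `T′_κ` to the left up to `β`
  have e1 : ⟪f, Tk' z⟫_𝕜 = ⟪w, z⟫_𝕜 + ⟪f, Tk' z - LinearMap.adjoint T z⟫_𝕜 := by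
    rw [← LinearMap.adjoint_inner_right T f z, ← inner_add_right, add_sub_cancel]
  have h1 : RCLike.re ⟪w, z⟫_𝕜 - β * ‖f‖ * ‖z‖ ≤ RCLike.re ⟪f, Tk' z⟫_𝕜 := by
    rw [e1, map_add]
    have := neg_mul_norm_le_re_inner' (𝕜 := 𝕜) f (Tk' z - LinearMap.adjoint T z)
    have h' : ‖f‖ * ‖Tk' z - LinearMap.adjoint T z‖ ≤ ‖f‖ * (β * ‖z‖) := mul_le_mul_of_nonneg_left (dT' z) (norm_nonneg _)
    nlinarith
  -- (2) split `z = Rw + (R_κ − R)(T_κ f) + R(T_κ f − Tf)`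
  have e2 : z = R w + ((Rk (Tk f) - R (Tk f)) + R (Tk f - T f)) := by
    rw [hz, hw, map_sub]; abel
  have nTk : ‖Tk f‖ ≤ ‖w‖ + β * ‖f‖ := by
    have := norm_add_le (T f) (Tk f - T f)
    rw [add_sub_cancel] at this
    linarith [dT f]
  have h2 : ‖R w‖ ^ 2 - ρ * ‖w‖ * (‖w‖ + β * ‖f‖) - ‖w‖ * (β * ‖f‖) ≤ RCLike.re ⟪w, z⟫_𝕜 := by
    rw [e2, inner_add_right, inner_add_right, map_add, map_add, hRsq]
    have a1 := neg_mul_norm_le_re_inner' (𝕜 := 𝕜) w (Rk (Tk f) - R (Tk f))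
    have a2 := neg_mul_norm_le_re_inner' (𝕜 := 𝕜) w (R (Tk f - T f))
    have b1 : ‖w‖ * ‖Rk (Tk f) - R (Tk f)‖ ≤ ‖w‖ * (ρ * (‖w‖ + β * ‖f‖)) :=
      mul_le_mul_of_nonneg_left ((dR _).trans (mul_le_mul_of_nonneg_left nTk hρ)) (norm_nonneg _)
    have b2 : ‖w‖ * ‖R (Tk f - T f)‖ ≤ ‖w‖ * (β * ‖f‖) :=
      mul_le_mul_of_nonneg_left ((hR1 _).trans (dT f)) (norm_nonneg _)
    nlinarith
  -- (3) the size of `z`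
  have nRk : ∀ s, ‖Rk s‖ ≤ (1 + ρ) * ‖s‖ := fun s => by
    have := norm_add_le (R s) (Rk s - R s)
    rw [add_sub_cancel] at this
    nlinarith [hR1 s, dR s]
  have h3 : ‖z‖ ≤ (1 + ρ) * (‖w‖ + β * ‖f‖) := (nRk _).trans (mul_le_mul_of_nonneg_left nTk (by linarith))
  -- (4) `‖w‖ ≤ ‖Rw‖ + C‖f‖`
  have h4 : ‖w‖ ≤ ‖R w‖ + C * ‖f‖ := by
    have := norm_add_le (R w) (w - R w)
    rw [add_sub_cancel] at this
    linarith [hP f]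
  -- bookkeeping: every product is kept as an atom, so that `linarith` chains the letters, and `poly_step` does the algebra
  have hf := norm_nonneg f
  have hRw := norm_nonneg (R w)
  have hβf : 0 ≤ β * ‖f‖ := mul_nonneg hβ hf
  have h4' : ‖w‖ + β * ‖f‖ ≤ ‖R w‖ + C * ‖f‖ + β * ‖f‖ := by linarith
  have k1 : β * ‖f‖ * ‖z‖ ≤ β * ‖f‖ * ((1 + ρ) * (‖w‖ + β * ‖f‖)) := mul_le_mul_of_nonneg_left h3 hβf
  have k2 : ρ * ‖w‖ * (‖w‖ + β * ‖f‖) ≤ ρ * (‖R w‖ + C * ‖f‖) * (‖R w‖ + C * ‖f‖ + β * ‖f‖) := by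
    have := mul_le_mul h4 h4' (by positivity) (by positivity)
    simpa only [mul_assoc] using mul_le_mul_of_nonneg_left this hρ
  have k3 : ‖w‖ * (β * ‖f‖) ≤ (‖R w‖ + C * ‖f‖) * (β * ‖f‖) := mul_le_mul_of_nonneg_right h4 hβf
  have k4 : β * ‖f‖ * ((1 + ρ) * (‖w‖ + β * ‖f‖)) ≤ β * ‖f‖ * ((1 + ρ) * (‖R w‖ + C * ‖f‖ + β * ‖f‖)) :=
    mul_le_mul_of_nonneg_left (mul_le_mul_of_nonneg_left h4' (by linarith)) hβf
  have P := poly_step (β := β) hRw hf hC hβ hρ hρ8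
  linarith [h1, h2, k1, k2, k3, k4, P]

end Projected

/-! ## §1 The structure `H = B₁†B₁ + B₂†RB₂ + K + aQ†Q` -/

section Structure

variable (B₁ : E →ₗ[𝕜] P) (B₂ : E →ₗ[𝕜] S) (R : S →ₗ[𝕜] S) (Q : E →ₗ[𝕜] F) (K H : E →ₗ[𝕜] E) (a : ℝ)
  (hRsq : ∀ s, RCLike.re ⟪s, R s⟫_𝕜 = ‖R s‖ ^ 2)
  (hH : ∀ f, H f = LinearMap.adjoint B₁ (B₁ f) + LinearMap.adjoint B₂ (R (B₂ f)) + K f + ((a : ℝ) : 𝕜) • LinearMap.adjoint Q (Q f))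

include hRsq hH in
/-- **`re⟪f, Hf⟫ = ‖B₁f‖² + ‖R(B₂f)‖² + re⟪f, Kf⟫ + a‖Qf‖²`** for `H = B₁†B₁ + B₂†RB₂ + K + aQ†Q` — the quadratic form of `Δ_a = D*D + Δ′ + DRD* + aQ*Q`
((3.26) with (3.10) and (3.21): `⟨A, D*DA⟩ = ‖DA‖²`, `⟨A, DRD*A⟩ = ‖RD*A‖²` since `R` is an orthogonal projection). [folklore]
[cite: Balaban1985BackgroundPropagators, (3.26) p.395, (3.21) p.394, (3.10) p.392] -/
theorem re_inner_H_eq (f : E) :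
    RCLike.re ⟪f, H f⟫_𝕜 = ‖B₁ f‖ ^ 2 + ‖R (B₂ f)‖ ^ 2 + RCLike.re ⟪f, K f⟫_𝕜 + a * ‖Q f‖ ^ 2 := by
  rw [hH, inner_add_right, inner_add_right, inner_add_right, map_add, map_add, map_add, LinearMap.adjoint_inner_right,
    LinearMap.adjoint_inner_right, inner_smul_real_right, RCLike.smul_re, LinearMap.adjoint_inner_right, inner_self_eq_norm_sq (𝕜 := 𝕜),
    hRsq, inner_self_eq_norm_sq (𝕜 := 𝕜)]

end Structure

/-! ## §2 The conjugated family: perturbed coercivity and `‖G_κ‖ ≤ 4∕γ` -/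

section Family

variable (B₁ : E →ₗ[𝕜] P) (B₂ : E →ₗ[𝕜] S) (R : S →ₗ[𝕜] S) (Q : E →ₗ[𝕜] F) (K H : E →ₗ[𝕜] E) (a γ β βK pK ρ CP : ℝ)
  (B₁k : E →ₗ[𝕜] P) (B₁k' : P →ₗ[𝕜] E) (B₂k : E →ₗ[𝕜] S) (B₂k' : S →ₗ[𝕜] E) (Rk : S →ₗ[𝕜] S) (Qk : E →ₗ[𝕜] F) (Qk' : F →ₗ[𝕜] E)
  (Kk Hk Gk : E →ₗ[𝕜] E)
  (ha : 0 ≤ a) (hγ : 0 < γ) (hβ : 0 ≤ β) (hρ : 0 ≤ ρ) (hCP : 0 ≤ CP)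
  (hRsq : ∀ s, RCLike.re ⟪s, R s⟫_𝕜 = ‖R s‖ ^ 2) (hR1 : ∀ s, ‖R s‖ ≤ ‖s‖)
  (hH : ∀ f, H f = LinearMap.adjoint B₁ (B₁ f) + LinearMap.adjoint B₂ (R (B₂ f)) + K f + ((a : ℝ) : 𝕜) • LinearMap.adjoint Q (Q f))
  (coercive : ∀ f, γ * ‖f‖ ^ 2 ≤ RCLike.re ⟪f, H f⟫_𝕜)
  (hKre : ∀ f, -(pK * ‖f‖ ^ 2) ≤ RCLike.re ⟪f, K f⟫_𝕜)
  (dB₁ : ∀ f, ‖B₁k f - B₁ f‖ ≤ β * ‖f‖) (dB₁' : ∀ p, ‖B₁k' p - LinearMap.adjoint B₁ p‖ ≤ β * ‖p‖)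
  (dB₂ : ∀ f, ‖B₂k f - B₂ f‖ ≤ β * ‖f‖) (dB₂' : ∀ s, ‖B₂k' s - LinearMap.adjoint B₂ s‖ ≤ β * ‖s‖)
  (dR : ∀ s, ‖Rk s - R s‖ ≤ ρ * ‖s‖)
  (dQ : ∀ f, ‖Qk f - Q f‖ ≤ β * ‖f‖) (dQ' : ∀ g, ‖Qk' g - LinearMap.adjoint Q g‖ ≤ β * ‖g‖)
  (dK : ∀ f, ‖Kk f - K f‖ ≤ βK * ‖f‖)
  (small : pK / 2 + (21 + 3 * a) * β ^ 2 + 4 * β * CP + 2 * ρ * CP ^ 2 + βK ≤ γ / 4)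
  (hHk : ∀ f, Hk f = B₁k' (B₁k f) + B₂k' (Rk (B₂k f)) + Kk f + ((a : ℝ) : 𝕜) • Qk' (Qk f)) (hHkGk : ∀ v, Hk (Gk v) = v)

include ha hβ hρ hCP hRsq hR1 hH coercive hKre dB₁ dB₁' dB₂ dB₂' dR dQ dQ' dK small hHk in
/-- **PERTURBED COERCIVITY** of `H_κ = B′_{1,κ}B_{1,κ} + B′_{2,κ}R_κB_{2,κ} + K_κ + aQ′_κQ_κ`: on the window
`p_K∕2 + (21 + 3a)β² + 4βC_P + 2ρC_P² + β_K ≤ γ∕4` (`ρ ≤ 1∕8`), `(γ∕4)‖f‖² ≤ re⟪f, H_κf⟫` — the two plain squares keep half of themselves up to `3β²`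
(`re_inner_perturbed`), the projected square up to `2ρC_P² + 4βC_P + 18β²` (`re_inner_projected_perturbed`), the three halves together are
`½(re⟪f,Hf⟫ − re⟪f,Kf⟫) ≥ ½γ‖f‖² − ½re⟪f,Kf⟫`, and `½re⟪f,Kf⟫ ≥ −½p_K‖f‖²`. [folklore]
[cite: Balaban1985BackgroundPropagators, (3.26) p.395, (3.21) p.394, (3.49) p.399, Thm 3.11 p.416; Balaban1985Variational, (110) p.294] -/
theorem coercive_k_projected (hρ8 : ρ ≤ 1 / 8) (hP : ∀ f, ‖B₂ f - R (B₂ f)‖ ≤ CP * ‖f‖) (f : E) :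
    γ / 4 * ‖f‖ ^ 2 ≤ RCLike.re ⟪f, Hk f⟫_𝕜 := by
  -- the remainder keeps its real-part lower bound up to `β_K` (as `B9Eq326ConjugatedLocalLetters.re_inner_Kk_ge`, re-derived inline)
  have pK' : RCLike.re ⟪f, K f⟫_𝕜 - βK * ‖f‖ ^ 2 ≤ RCLike.re ⟪f, Kk f⟫_𝕜 := by
    have e : ⟪f, Kk f⟫_𝕜 = ⟪f, K f⟫_𝕜 + ⟪f, Kk f - K f⟫_𝕜 := by rw [← inner_add_right, add_sub_cancel]
    rw [e, map_add]
    have h1 := neg_mul_norm_le_re_inner' (𝕜 := 𝕜) f (Kk f - K f)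
    have h2 : ‖f‖ * ‖Kk f - K f‖ ≤ ‖f‖ * (βK * ‖f‖) := mul_le_mul_of_nonneg_left (dK f) (norm_nonneg _)
    nlinarith [h1, h2]
  have e : RCLike.re ⟪f, Hk f⟫_𝕜 = RCLike.re ⟪f, B₁k' (B₁k f)⟫_𝕜 + RCLike.re ⟪f, B₂k' (Rk (B₂k f))⟫_𝕜 + RCLike.re ⟪f, Kk f⟫_𝕜 +
      a * RCLike.re ⟪f, Qk' (Qk f)⟫_𝕜 := by
    rw [hHk, inner_add_right, inner_add_right, inner_add_right, map_add, map_add, map_add, inner_smul_real_right, RCLike.smul_re]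
  have e0 := re_inner_H_eq B₁ B₂ R Q K H a hRsq hH f
  have p1 := re_inner_perturbed B₁ B₁k B₁k' hβ dB₁ dB₁' f
  have p2 := re_inner_projected_perturbed B₂ R B₂k B₂k' Rk hβ hρ hρ8 hCP hRsq hR1 dB₂ dB₂' dR hP f
  have pQ := mul_le_mul_of_nonneg_left (re_inner_perturbed Q Qk Qk' hβ dQ dQ' f) ha
  have sm := mul_le_mul_of_nonneg_right small (sq_nonneg ‖f‖)
  have co := coercive f
  have hk := hKre f
  have hq : 0 ≤ a * ‖Q f‖ ^ 2 := by positivity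
  nlinarith [e, e0, p1, p2, pQ, pK', sm, co, hk, hq]

include ha hγ hβ hρ hCP hRsq hR1 hH coercive hKre dB₁ dB₁' dB₂ dB₂' dR dQ dQ' dK small hHk hHkGk in
/-- **`‖G_κ‖ ≤ 4∕γ`** for any right inverse `G_κ` of the conjugated `Δ_a`-shaped operator (`H_κG_κ = 1`), given the projection letters `ρ ≤ 1∕8` and
`‖(1 − R)B₂‖ ≤ C_P`: `(γ∕4)‖G_κv‖² ≤ re⟪G_κv, v⟫ ≤ ‖G_κv‖‖v‖`.
[folklore] [cite: Balaban1985BackgroundPropagators, (3.26) p.395, (3.49) p.399, Thm 3.11 p.416; Balaban1985Variational, (110) p.294] -/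
theorem norm_Gk_le_projected (hρ8 : ρ ≤ 1 / 8) (hP : ∀ f, ‖B₂ f - R (B₂ f)‖ ≤ CP * ‖f‖) (v : E) : ‖Gk v‖ ≤ 4 / γ * ‖v‖ := by
  have h1 := coercive_k_projected B₁ B₂ R Q K H a γ β βK pK ρ CP B₁k B₁k' B₂k B₂k' Rk Qk Qk' Kk Hk ha hβ hρ hCP hRsq hR1 hH coercive hKre
    dB₁ dB₁' dB₂ dB₂' dR dQ dQ' dK small hHk hρ8 hP (Gk v)
  rw [hHkGk] at h1
  have h2 := re_inner_le_mul_norm' (𝕜 := 𝕜) (Gk v) v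
  by_cases hx : Gk v = 0
  · rw [hx, norm_zero]; positivity
  · have hxpos : 0 < ‖Gk v‖ := norm_pos_iff.mpr hx
    rw [div_mul_eq_mul_div, le_div_iff₀ hγ]
    nlinarith [h1, h2, hxpos, norm_nonneg v]

end Family

/-! ## §2′ The unconjugated reading (`β = β_K = ρ = 0`) -/

section Base

variable (B₁ : E →ₗ[𝕜] P) (B₂ : E →ₗ[𝕜] S) (R : S →ₗ[𝕜] S) (Q : E →ₗ[𝕜] F) (K H G : E →ₗ[𝕜] E) (a γ pK CP : ℝ)
  (ha : 0 ≤ a) (hγ : 0 < γ) (hCP : 0 ≤ CP)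
  (hRsq : ∀ s, RCLike.re ⟪s, R s⟫_𝕜 = ‖R s‖ ^ 2) (hR1 : ∀ s, ‖R s‖ ≤ ‖s‖)
  (hH : ∀ f, H f = LinearMap.adjoint B₁ (B₁ f) + LinearMap.adjoint B₂ (R (B₂ f)) + K f + ((a : ℝ) : 𝕜) • LinearMap.adjoint Q (Q f))
  (coercive : ∀ f, γ * ‖f‖ ^ 2 ≤ RCLike.re ⟪f, H f⟫_𝕜) (hKre : ∀ f, -(pK * ‖f‖ ^ 2) ≤ RCLike.re ⟪f, K f⟫_𝕜) (small : pK / 2 ≤ γ / 4)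
  (hHG : ∀ v, H (G v) = v)

include ha hγ hCP hRsq hR1 hH coercive hKre small hHG in
/-- `‖Δ_a⁻¹‖ ≤ 4∕γ` for the unconjugated projected-square operator whenever `p_K ≤ γ∕2`, for every bound `C_P` of the complementary part (the
`β = β_K = ρ = 0` reading of `norm_Gk_le_projected`; the sharp `γ⁻¹` is `B9Eq3126GreenLetters.norm_greenK_le`). [folklore]
[cite: Balaban1985BackgroundPropagators, (3.26) p.395, Thm 3.11 p.416] -/
theorem norm_G_le_projected (hP : ∀ f, ‖B₂ f - R (B₂ f)‖ ≤ CP * ‖f‖) (v : E) : ‖G v‖ ≤ 4 / γ * ‖v‖ :=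
  norm_Gk_le_projected B₁ B₂ R Q K H a γ 0 0 pK 0 CP B₁ (LinearMap.adjoint B₁) B₂ (LinearMap.adjoint B₂) R Q (LinearMap.adjoint Q) K H G ha hγ
    le_rfl le_rfl hCP hRsq hR1 hH coercive hKre (fun f => by simp) (fun p => by simp) (fun f => by simp) (fun s => by simp) (fun s => by simp)
    (fun f => by simp) (fun g => by simp) (fun f => by simp) (by nlinarith) hH hHG (by norm_num) hP v

end Base

end Literature.MathematicalPhysics.QuantumFieldTheory.Balaban1983to89.B9Eq326ConjugatedDeltaALetters

end
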